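import Summits.HubbardSuperconductivity.HubbardSuperconductivity.Theorems.AnisotropyChordTransferFibre3RateLemma

/-!
# Route `AnisotropyChord` / H0 rotor rung: PartN39 — the RING CORRECTION IDENTITY, PROVED

PORT PartN39 (`…Fibre3RateLemma`, theory seat `hubbard-h0-rotor-theory-1` g21, memo 21 §322(a)) types
`RateLemma.RingCorrectionIdentity L`: for `0 < p < L`, `0 ≤ y ≤ L/2`, `μ = μ_p`,
`R_L(p;y) − R_∞(p;y) = e^{−yμ}(e^{−Lμ} + e^{−(L−2y)μ})/((1 − e^{−Lμ})·2 sinh μ)`.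
This file proves it (`ringCorrectionIdentity_holds`): with `u = e^{yμ}`, `w = e^{Lμ/2}` both sides are the rational
function `(u² + w²)/(u(w² − 1))·1/(2 sinh μ)`; the degenerate case `μ = 0` holds by the `x/0 = 0` convention
(both sides vanish), so no positivity of `μ_p` is needed.
Prover seat `hubbard-h0-rotor-p2` g0; helper for stmt-HubbardSuperconductivity-19089 (`--supports`, helper class).
WHAT THIS IS NOT: nothing here proves superconductivity in the Hubbard model; helper identity of ONE conditional reduction
(rung 19089, HOLE₂(.75) near-pair tail, periodisation at `λ = 0`).  Mathlib + tree imports only; no sorry, no axioms.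
-/

set_option linter.dupNamespace false

noncomputable section

namespace Summit.HubbardSuperconductivity.HubbardSuperconductivity.Theorems.AnisotropyChord.Transfer.Fibre3

namespace RateLemma

open Real

variable (L : ℕ) [NeZero L]

/-- the exponential algebra behind the ring correction: for `μ ≠ 0`, `0 < L`,
`cosh((L/2 − y)μ)/(2 s · sinh(Lμ/2)) − e^{−yμ}/(2 s) = e^{−yμ}(e^{−Lμ} + e^{−(L−2y)μ})/((1 − e^{−Lμ}) 2 s)`. -/
theorem ring_correction_algebra (Lr μ y s : ℝ) (hμ : μ ≠ 0) (hL : 0 < Lr) :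
    Real.cosh ((Lr / 2 - y) * μ) / (2 * s * Real.sinh (Lr * μ / 2)) - Real.exp (-(y * μ)) / (2 * s)
      = Real.exp (-(y * μ)) * (Real.exp (-(Lr * μ)) + Real.exp (-((Lr - 2 * y) * μ)))
          / ((1 - Real.exp (-(Lr * μ))) * (2 * s)) := by
  rcases eq_or_ne s 0 with hs | hs
  · subst hs; simp
  set u := Real.exp (y * μ) with hu
  set w := Real.exp (Lr * μ / 2) with hw
  have hu0 : 0 < u := Real.exp_pos _
  have hw0 : 0 < w := Real.exp_pos _
  have hw1 : w ≠ 1 := by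
    rw [hw]
    intro h
    rw [Real.exp_eq_one_iff] at h
    have : Lr * μ = 0 := by linarith
    rcases mul_eq_zero.1 this with h1 | h1
    · exact absurd h1 hL.ne'
    · exact hμ h1
  have e1 : Real.exp (-(y * μ)) = u⁻¹ := by rw [Real.exp_neg]
  have e2 : Real.exp (-(Lr * μ)) = (w * w)⁻¹ := by
    rw [Real.exp_neg, hw, ← Real.exp_add]; ring_nf
  have e3 : Real.exp (-((Lr - 2 * y) * μ)) = u * u * (w * w)⁻¹ := by
    rw [hu, hw, ← Real.exp_add, ← Real.exp_add, ← Real.exp_neg, ← Real.exp_add]; ring_nf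
  have e4 : Real.cosh ((Lr / 2 - y) * μ) = (w * u⁻¹ + u * w⁻¹) / 2 := by
    rw [Real.cosh_eq, hu, hw, ← Real.exp_neg, ← Real.exp_neg, ← Real.exp_add, ← Real.exp_add]
    ring_nf
  have e5 : Real.sinh (Lr * μ / 2) = (w - w⁻¹) / 2 := by
    rw [Real.sinh_eq, hw, ← Real.exp_neg]
  rw [e1, e2, e3, e4, e5]
  have hw2 : w * w - 1 ≠ 0 := by
    intro h
    have : (w - 1) * (w + 1) = 0 := by ring_nf; linarith
    rcases mul_eq_zero.1 this with h1 | h1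
    · exact hw1 (by linarith)
    · linarith
  have hw2' : -1 + w ^ 2 ≠ 0 := fun h => hw2 (by linarith [h])
  have hw2'' : w ^ 2 - 1 ≠ 0 := fun h => hw2 (by linarith [h])
  have hw3 : w - w⁻¹ ≠ 0 := by
    rw [show w - w⁻¹ = (w * w - 1) / w by field_simp]
    exact div_ne_zero hw2 hw0.ne'
  field_simp
  ring

omit [NeZero L] in
/-- ★ `RingCorrectionIdentity` holds. -/
theorem ringCorrectionIdentity_holds : RingCorrectionIdentity L := by
  intro p hp hpL y hy hyL
  have hL : (0 : ℝ) < L := by exact_mod_cast lt_trans hp hpL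
  unfold ringR planeR
  set μ := rowMu L p with hμdef
  rcases eq_or_ne μ 0 with hμ | hμ
  · -- degenerate row: both sides vanish
    simp [hμ]
  · rw [show ((L : ℝ) / 2 - y) * μ = ((L : ℝ) / 2 - y) * μ from rfl,
      show 2 * Real.sinh μ * Real.sinh ((L : ℝ) * μ / 2) = 2 * Real.sinh μ * Real.sinh ((L : ℝ) * μ / 2) from rfl]
    exact ring_correction_algebra (L : ℝ) μ y (Real.sinh μ) hμ hL

end RateLemma

end Summit.HubbardSuperconductivity.HubbardSuperconductivity.Theorems.AnisotropyChord.Transfer.Fibre3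

end
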